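import Mathlib
import HarnessLib
import Literature.Computability.AlgebraicComplexity.DivisionSLP
import Summits.MatrixMultiplication.MatrixMultiplication.Theses.CondensationDistance
import Summits.MatrixMultiplication.MatrixMultiplication.Theorems.CondensationDistanceCondensationSoundStubThreeTerm
import Summits.MatrixMultiplication.MatrixMultiplication.Theorems.CondensationDistanceCondensationSoundStubTransport
import Summits.MatrixMultiplication.MatrixMultiplication.Theorems.CondensationDistanceCondensationSoundStubNonvanishing
import Summits.MatrixMultiplication.MatrixMultiplication.Theorems.CondensationDistanceCondensationSoundStubBallShape
import Summits.MatrixMultiplication.MatrixMultiplication.Theorems.CondensationDistanceCondensationSoundStubBallValues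
import Summits.MatrixMultiplication.MatrixMultiplication.Theorems.CondensationDistanceCondensationSoundStubTarget
import Summits.MatrixMultiplication.MatrixMultiplication.Theorems.CondensationDistanceCondensationSoundStubSimulation

/-!
# Crux `CondensationSound` (stmt-MatrixMultiplication-15939) — line `Sketch`: raw maximal minors of `[1 | Z]`

Route `CondensationDistance` (deciding theorem `closes : ShortCondensation → CondensationSound →
DerivationsBoundOmega → MatrixMultiplication`).  The crux is the SOUNDNESS bridge: a valid octahedral Plücker
derivation `f : Fin l → Finset (Fin (n + m'))` listing the target set `{n ≤ x < 2n}` yields, in the tree's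
division-SLP model `Derivable` (BCS Def. (4.4)/(4.7), `Literature/…/DivisionSLP.lean`), a computation of
`det X` from the entries of the generic `n × m'` matrix `Z = [X | Y]` over `ℂ(Z)` of length `≤ 5·l`.

## The line (cards `cramer-update-exchange` + `raw-minors-unit-absorption`)

* Coordinates: `P J := det ([1 | Z] ∘ e_J)`, `e_J` the SORTED enumeration (`Finset.orderEmbOfFin`) of the `n`-set
  `J ⊆ Fin (n + m')`, where `[1 | Z] := (fromCols 1 Z) ∘ finSumFinEquiv.symm` (identity columns `castAdd m' i`,
  `Z`-columns `natAdd n j`), pushed into `ℂ(Z) = FractionRing ℂ[Z]`.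
* Exchange (`stub_threeTerm`, generic): for ANY matrix `M`, tuple `e`, positions `a ≠ b` and values `u v`,
  `det M_e · det M_{e[a↦u][b↦v]} = det M_{e[a↦u]} · det M_{e[b↦v]} − det M_{e[a↦v]} · det M_{e[b↦u]}`
  (Cramer's rule read through the linear functional `w ↦ det (X.updateCol a w)`); the five updated tuples
  enumerate exactly the route's five octahedron mates `J−p+u, J−q+v, J−p+v, J−q+u, J−p−q+u+v`, and two injective
  enumerations of one set give determinants differing by the sign of a permutation (`stub_transport`,
  `Matrix.det_permute'`), so the set-indexed exchange relation holds with `ε₁, ε₂ ∈ {±1}` (`exchange_of_stubs`).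
* Ball: an `n`-set with at most one element `≥ n` is `range castAdd` or `range (castAdd[i ↦ natAdd j])`
  (`stub_ballShape`), where `[1|Z]` has determinant `1`, resp. `Z i j` (`stub_ballValues`, `Matrix.cramer_one`); so
  ball values are inputs/constants UP TO A SIGN — which the cost model never charges for: the scalars of a
  `DivStep` linear combination are free, so one octahedron is still `mul, mul, lin, inv, mul` = 5 steps with EXACT
  output (`octahedron_five_steps`, `stub_simulation`).
* Divisors: every maximal minor of `[1 | Z]` on an injective tuple is a nonzero polynomial (`stub_nonvanishing`, the
  `GL_n` gauge `Z ↦ Y₁⁻¹ Y₂` + `Matrix.det_mvPolynomialX_ne_zero`).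
* Target: the sorted enumeration of `{n ≤ x < 2n}` is `j ↦ natAdd n (castLE h j)`, on which `[1 | Z]` is the
  crux's matrix `of fun i j => X (i, castLE h j)` on the nose (`stub_target`), so the target value is `+det X`.

The seven registered stubs of the line are proved in the imported files
`Theorems/CondensationDistanceCondensationSoundStub{ThreeTerm,Transport,Nonvanishing,BallShape,BallValues,Target,
Simulation}.lean` (`stub_threeTerm` p158817, `stub_transport` p158674, `stub_nonvanishing` p158816, `stub_ballShape`
p158938, `stub_ballValues` p158742, `stub_target` p158815, `stub_simulation` p158855); this file is the glue
(`exchange_of_stubs`, `ball_of_stubs`, `nonvanishing_of_stubs`, `target_of_stubs`) and the composition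
`CondensationSound_of : CondensationSound`, the crux BY NAME.  Sources: BurgisserClausenShokrollahi1997 Def. (4.4)/(4.7)
(the cost model), FallatJohnson2011 §1.2 / FominGrigorievKoshevoy2014 (three-term Plücker relations as algorithm steps),
idea cards `Cruxes/CondensationSound/Ideas/{cramer-update-exchange,raw-minors-unit-absorption}.md`.
-/

set_option linter.dupNamespace false

namespace Summit.MatrixMultiplication.MatrixMultiplication.Theorems.CondensationSound

open scoped BigOperators Matrix
open Literature.Computability.AlgebraicComplexity (Derivable DivStep DivSeq)
open Summit.MatrixMultiplication.MatrixMultiplication.Theses.CondensationDistance (CondensationSound)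

/-! ## Glue: tuples, ranges, signs -/

/-- Updating an injective tuple at one position with a fresh value keeps it injective. [folklore] -/
theorem update_injective_of_notMem {k : ℕ} {ι : Type} {e : Fin k → ι} (he : Function.Injective e)
    (a : Fin k) {u : ι} (hu : u ∉ Set.range e) : Function.Injective (Function.update e a u) := by
  intro x y hxy
  by_cases hx : x = a <;> by_cases hy : y = a
  · exact hx.trans hy.symm
  · subst hx
    rw [Function.update_self, Function.update_of_ne hy] at hxy
    exact absurd ⟨y, hxy.symm⟩ hu
  · subst hy
    rw [Function.update_self, Function.update_of_ne hx] at hxy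
    exact absurd ⟨x, hxy⟩ hu
  · rw [Function.update_of_ne hx, Function.update_of_ne hy] at hxy
    exact he hxy

/-- The range of an injective tuple updated at position `a`: the old value `e a` is traded for the new one.
[folklore] -/
theorem range_update_of_injective {k : ℕ} {ι : Type} {e : Fin k → ι} (he : Function.Injective e)
    (a : Fin k) (u : ι) : Set.range (Function.update e a u) = insert u (Set.range e \ {e a}) := by
  ext x
  simp only [Set.mem_range, Set.mem_insert_iff, Set.mem_sdiff, Set.mem_singleton_iff]
  constructor
  · rintro ⟨c, rfl⟩
    by_cases hc : c = a
    · subst hc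
      exact Or.inl (Function.update_self _ _ _)
    · rw [Function.update_of_ne hc]
      exact Or.inr ⟨⟨c, rfl⟩, fun h => hc (he h)⟩
  · rintro (rfl | ⟨⟨c, rfl⟩, hne⟩)
    · exact ⟨a, Function.update_self _ _ _⟩
    · refine ⟨c, ?_⟩
      rw [Function.update_of_ne]
      rintro rfl
      exact hne rfl

/-- A finset whose coercion is the range of an injective `k`-tuple has `k` elements. [folklore] -/
theorem card_eq_of_coe_eq_range {k : ℕ} {ι : Type} [DecidableEq ι] {J : Finset ι} {t : Fin k → ι}
    (ht : Function.Injective t) (h : (↑J : Set ι) = Set.range t) : J.card = k := by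
  have hJ : J = Finset.univ.image t := by
    ext x
    rw [← Finset.mem_coe, h]
    simp
  rw [hJ, Finset.card_image_of_injective _ ht, Finset.card_univ, Fintype.card_fin]

/-- `x = y ∨ x = -y` in `ℂ[Z]` becomes `φ x = ε • φ y` and `φ y = ε • φ x` in `ℂ(Z)` with `ε = ±1`. [folklore] -/
theorem exists_smul_of_eq_or_eq_neg {Rg K : Type} [CommRing Rg] [Field K] [Algebra Rg K] [Algebra ℂ K]
    {x y : Rg} (h : x = y ∨ x = -y) :
    ∃ ε : ℂ, ε ≠ 0 ∧ algebraMap Rg K x = ε • algebraMap Rg K y ∧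
      algebraMap Rg K y = ε • algebraMap Rg K x := by
  rcases h with rfl | rfl
  · exact ⟨1, one_ne_zero, by simp, by simp⟩
  · exact ⟨-1, by norm_num, by simp, by simp⟩

/-! ## Glue: the four local properties of the raw-minor coordinates -/

section Coordinates

variable (n m' : ℕ)

variable (P : Finset (Fin (n + m')) → FractionRing (MvPolynomial (Fin n × Fin m') ℂ))
  (hP : ∀ (J : Finset (Fin (n + m'))) (hJ : J.card = n),
    P J = (algebraMap (MvPolynomial (Fin n × Fin m') ℂ) (FractionRing (MvPolynomial (Fin n × Fin m') ℂ))) (((Matrix.fromCols (1 : Matrix (Fin n) (Fin n) (MvPolynomial (Fin n × Fin m') ℂ))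
        (Matrix.of fun i j => MvPolynomial.X (i, j))).submatrix id ⇑finSumFinEquiv.symm).submatrix id ⇑(J.orderEmbOfFin hJ)).det)

include hP

/-- **Exchange relation for the set-indexed raw-minor coordinates** (from `stub_threeTerm` and
`stub_transport`): enumerate `J` increasingly by `e`, let `e a = p`, `e b = q`; the five updated tuples are
injective enumerations of the five mates, so their minors are `±` the set coordinates, and the update-form
identity gives the relation with `ε₁, ε₂ ∈ {±1}`. [folklore] -/
theorem exchange_of_stubs :
    ∀ (J : Finset (Fin (n + m'))) (p q u v : Fin (n + m')),
      J.card = n → p ∈ J → q ∈ J → p ≠ q → u ∉ J → v ∉ J → u ≠ v →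
        ∃ ε₁ ε₂ : ℂ,
          P J * P (insert u (insert v ((J.erase p).erase q))) =
            ε₁ • (P (insert u (J.erase p)) * P (insert v (J.erase q))) +
              ε₂ • (P (insert v (J.erase p)) * P (insert u (J.erase q))) := by
  intro J p q u v hJ hp hq hpq hu hv huv
  classical
  -- the sorted enumeration of `J` and the positions of `p`, `q`
  set e : Fin n → Fin (n + m') := ⇑(J.orderEmbOfFin hJ) with he_def
  have he : Function.Injective e := (J.orderEmbOfFin hJ).injective
  have hre : Set.range e = ↑J := Finset.range_orderEmbOfFin J hJ
  obtain ⟨a, ha⟩ : p ∈ Set.range e := by rw [hre]; exact hp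
  obtain ⟨b, hb⟩ : q ∈ Set.range e := by rw [hre]; exact hq
  have hab : a ≠ b := fun h => hpq (by rw [← ha, ← hb, h])
  have hu' : u ∉ Set.range e := by rw [hre]; exact hu
  have hv' : v ∉ Set.range e := by rw [hre]; exact hv
  -- the five update tuples: injectivity and ranges
  have hi₁ : Function.Injective (Function.update e a u) := update_injective_of_notMem he a hu'
  have hi₂ : Function.Injective (Function.update e a v) := update_injective_of_notMem he a hv'
  have hi₃ : Function.Injective (Function.update e b u) := update_injective_of_notMem he b hu'
  have hi₄ : Function.Injective (Function.update e b v) := update_injective_of_notMem he b hv'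
  have h₁b : Function.update e a u b = q := by rw [Function.update_of_ne hab.symm, hb]
  have hi₅ : Function.Injective (Function.update (Function.update e a u) b v) := by
    refine update_injective_of_notMem hi₁ b ?_
    rw [range_update_of_injective he]
    rintro (h | ⟨h, -⟩)
    · exact huv h.symm
    · exact hv' h
  have hr₁ : (↑(insert u (J.erase p)) : Set (Fin (n + m'))) = Set.range (Function.update e a u) := by
    rw [range_update_of_injective he, Finset.coe_insert, Finset.coe_erase, hre, ha]
  have hr₂ : (↑(insert v (J.erase p)) : Set (Fin (n + m'))) = Set.range (Function.update e a v) := by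
    rw [range_update_of_injective he, Finset.coe_insert, Finset.coe_erase, hre, ha]
  have hr₃ : (↑(insert u (J.erase q)) : Set (Fin (n + m'))) = Set.range (Function.update e b u) := by
    rw [range_update_of_injective he, Finset.coe_insert, Finset.coe_erase, hre, hb]
  have hr₄ : (↑(insert v (J.erase q)) : Set (Fin (n + m'))) = Set.range (Function.update e b v) := by
    rw [range_update_of_injective he, Finset.coe_insert, Finset.coe_erase, hre, hb]
  have hr₅ : (↑(insert u (insert v ((J.erase p).erase q))) : Set (Fin (n + m'))) =
      Set.range (Function.update (Function.update e a u) b v) := by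
    rw [range_update_of_injective hi₁, h₁b, range_update_of_injective he, ha, Finset.coe_insert,
      Finset.coe_insert, Finset.coe_erase, Finset.coe_erase, hre]
    have huq : u ≠ q := fun h => hu (h ▸ hq)
    ext x
    simp only [Set.mem_insert_iff, Set.mem_sdiff, Set.mem_singleton_iff]
    constructor
    · rintro (rfl | rfl | ⟨⟨hx, hxp⟩, hxq⟩)
      · exact Or.inr ⟨Or.inl rfl, huq⟩
      · exact Or.inl rfl
      · exact Or.inr ⟨Or.inr ⟨hx, hxp⟩, hxq⟩
    · rintro (rfl | ⟨rfl | ⟨hx, hxp⟩, hxq⟩)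
      · exact Or.inr (Or.inl rfl)
      · exact Or.inl rfl
      · exact Or.inr (Or.inr ⟨⟨hx, hxp⟩, hxq⟩)
  -- cards of the five mates
  have hc₁ : (insert u (J.erase p)).card = n := card_eq_of_coe_eq_range hi₁ hr₁
  have hc₂ : (insert v (J.erase p)).card = n := card_eq_of_coe_eq_range hi₂ hr₂
  have hc₃ : (insert u (J.erase q)).card = n := card_eq_of_coe_eq_range hi₃ hr₃
  have hc₄ : (insert v (J.erase q)).card = n := card_eq_of_coe_eq_range hi₄ hr₄
  have hc₅ : (insert u (insert v ((J.erase p).erase q))).card = n := card_eq_of_coe_eq_range hi₅ hr₅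
  -- transport each sorted enumeration to the update tuple (signs `±1`)
  have key : ∀ (J' : Finset (Fin (n + m'))) (hJ' : J'.card = n) (t : Fin n → Fin (n + m')),
      Function.Injective t → (↑J' : Set (Fin (n + m'))) = Set.range t →
        ∃ ε : ℂ, ε ≠ 0 ∧ (algebraMap (MvPolynomial (Fin n × Fin m') ℂ) (FractionRing (MvPolynomial (Fin n × Fin m') ℂ))) (((Matrix.fromCols (1 : Matrix (Fin n) (Fin n) (MvPolynomial (Fin n × Fin m') ℂ))
        (Matrix.of fun i j => MvPolynomial.X (i, j))).submatrix id ⇑finSumFinEquiv.symm).submatrix id t).det = ε • P J' ∧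
          P J' = ε • (algebraMap (MvPolynomial (Fin n × Fin m') ℂ) (FractionRing (MvPolynomial (Fin n × Fin m') ℂ))) (((Matrix.fromCols (1 : Matrix (Fin n) (Fin n) (MvPolynomial (Fin n × Fin m') ℂ))
        (Matrix.of fun i j => MvPolynomial.X (i, j))).submatrix id ⇑finSumFinEquiv.symm).submatrix id t).det := by
    intro J' hJ' t ht hrt
    have h := stub_transport (MvPolynomial (Fin n × Fin m') ℂ) n (Fin (n + m')) ((Matrix.fromCols (1 : Matrix (Fin n) (Fin n) (MvPolynomial (Fin n × Fin m') ℂ))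
        (Matrix.of fun i j => MvPolynomial.X (i, j))).submatrix id ⇑finSumFinEquiv.symm) t
      ⇑(J'.orderEmbOfFin hJ') ht (J'.orderEmbOfFin hJ').injective
      (by rw [Finset.range_orderEmbOfFin, hrt])
    obtain ⟨ε, hε, h1, h2⟩ := exists_smul_of_eq_or_eq_neg
      (K := FractionRing (MvPolynomial (Fin n × Fin m') ℂ)) h
    exact ⟨ε, hε, by rw [hP J' hJ']; exact h2, by rw [hP J' hJ']; exact h1⟩
  obtain ⟨ε₁, -, h₁, -⟩ := key _ hc₁ _ hi₁ hr₁
  obtain ⟨ε₂, -, h₂, -⟩ := key _ hc₂ _ hi₂ hr₂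
  obtain ⟨ε₃, -, h₃, -⟩ := key _ hc₃ _ hi₃ hr₃
  obtain ⟨ε₄, -, h₄, -⟩ := key _ hc₄ _ hi₄ hr₄
  obtain ⟨ε₅, -, -, h₅⟩ := key _ hc₅ _ hi₅ hr₅
  -- the update-form three-term identity, pushed to `ℂ(Z)`
  have h3 := congrArg (algebraMap (MvPolynomial (Fin n × Fin m') ℂ) (FractionRing (MvPolynomial (Fin n × Fin m') ℂ))) (stub_threeTerm (MvPolynomial (Fin n × Fin m') ℂ) n (Fin (n + m')) ((Matrix.fromCols (1 : Matrix (Fin n) (Fin n) (MvPolynomial (Fin n × Fin m') ℂ))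
        (Matrix.of fun i j => MvPolynomial.X (i, j))).submatrix id ⇑finSumFinEquiv.symm) e a b u v hab)
  rw [map_mul, map_sub, map_mul, map_mul, h₁, h₂, h₃, h₄] at h3
  refine ⟨ε₅ * ε₁ * ε₄, -(ε₅ * ε₂ * ε₃), ?_⟩
  rw [hP J hJ, h₅, ← he_def]
  simp only [Algebra.smul_def, map_mul, map_neg] at h3 ⊢
  linear_combination (algebraMap ℂ (FractionRing (MvPolynomial (Fin n × Fin m') ℂ)) ε₅) * h3

/-- **Ball values are inputs or constants up to a sign** (from `stub_ballShape`, `stub_ballValues`,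
`stub_transport`). [folklore] -/
theorem ball_of_stubs :
    ∀ J : Finset (Fin (n + m')), J.card = n →
      (J.filter fun x : Fin (n + m') => n ≤ x.val).card ≤ 1 →
        ∃ ε : ℂ, ε ≠ 0 ∧ ε • P J ∈
          (Set.range fun p : Fin n × Fin m' => (algebraMap (MvPolynomial (Fin n × Fin m') ℂ) (FractionRing (MvPolynomial (Fin n × Fin m') ℂ))) (MvPolynomial.X p)) ∪
            Set.range (algebraMap ℂ (FractionRing (MvPolynomial (Fin n × Fin m') ℂ))) := by
  intro J hJ hball
  classical
  have key : ∀ (t : Fin n → Fin (n + m')), Function.Injective t →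
      (↑J : Set (Fin (n + m'))) = Set.range t →
        ∃ ε : ℂ, ε ≠ 0 ∧ ε • P J = (algebraMap (MvPolynomial (Fin n × Fin m') ℂ) (FractionRing (MvPolynomial (Fin n × Fin m') ℂ))) (((Matrix.fromCols (1 : Matrix (Fin n) (Fin n) (MvPolynomial (Fin n × Fin m') ℂ))
        (Matrix.of fun i j => MvPolynomial.X (i, j))).submatrix id ⇑finSumFinEquiv.symm).submatrix id t).det := by
    intro t ht hrt
    have h := stub_transport (MvPolynomial (Fin n × Fin m') ℂ) n (Fin (n + m')) ((Matrix.fromCols (1 : Matrix (Fin n) (Fin n) (MvPolynomial (Fin n × Fin m') ℂ))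
        (Matrix.of fun i j => MvPolynomial.X (i, j))).submatrix id ⇑finSumFinEquiv.symm)
      ⇑(J.orderEmbOfFin hJ) t (J.orderEmbOfFin hJ).injective ht
      (by rw [Finset.range_orderEmbOfFin, hrt])
    obtain ⟨ε, hε, h1, -⟩ := exists_smul_of_eq_or_eq_neg
      (K := FractionRing (MvPolynomial (Fin n × Fin m') ℂ)) h
    exact ⟨ε, hε, by rw [hP J hJ]; exact h1.symm⟩
  obtain ⟨hone, hupd⟩ := stub_ballValues n m'
  rcases stub_ballShape n m' J hJ hball with h0 | ⟨i, j, h1⟩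
  · obtain ⟨ε, hε, h⟩ := key (Fin.castAdd m') (Fin.castAdd_injective n m') h0
    refine ⟨ε, hε, Or.inr ⟨1, ?_⟩⟩
    rw [h, hone, map_one, map_one]
  · have hinj : Function.Injective (Function.update (Fin.castAdd m') i (Fin.natAdd n j)) := by
      refine update_injective_of_notMem (Fin.castAdd_injective n m') i ?_
      rintro ⟨x, hx⟩
      have := congrArg Fin.val hx
      simp only [Fin.val_castAdd, Fin.val_natAdd] at this
      omega
    obtain ⟨ε, hε, h⟩ := key _ hinj h1
    refine ⟨ε, hε, Or.inl ⟨(i, j), ?_⟩⟩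
    rw [h, hupd]

/-- **Nonvanishing of the coordinates** (from `stub_nonvanishing`; `ℂ[Z] → ℂ(Z)` is injective). [folklore] -/
theorem nonvanishing_of_stubs : ∀ J : Finset (Fin (n + m')), J.card = n → P J ≠ 0 := by
  intro J hJ
  rw [hP J hJ]
  exact fun h => stub_nonvanishing n m' _ (J.orderEmbOfFin hJ).injective
    ((IsFractionRing.injective (MvPolynomial (Fin n × Fin m') ℂ)
      (FractionRing (MvPolynomial (Fin n × Fin m') ℂ))) (by rw [h, map_zero]))

/-- **The target value is `+det X`** (from `stub_target`). [folklore] -/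
theorem target_of_stubs (h : n ≤ m') :
    P (Finset.univ.filter fun x : Fin (n + m') => n ≤ x.val ∧ x.val < 2 * n) =
      (algebraMap (MvPolynomial (Fin n × Fin m') ℂ) (FractionRing (MvPolynomial (Fin n × Fin m') ℂ))) (Matrix.det (Matrix.of fun i j : Fin n => MvPolynomial.X (i, Fin.castLE h j))) := by
  obtain ⟨hc, hdet⟩ := stub_target n m' h
  rw [hP _ hc, hdet]

end Coordinates

/-! ## The composition: the crux BY NAME -/

/-- **THE SKELETON THEOREM.** The crux
`Summit.MatrixMultiplication.MatrixMultiplication.Theses.CondensationDistance.CondensationSound`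
(stmt-MatrixMultiplication-15939): run `stub_simulation` on the raw-minor coordinate system
`P J := φ (det ([1|Z] ∘ sorted J))` (for `|J| = n`; junk `0` otherwise, never used), whose three prerequisites
are `ball_of_stubs`, `nonvanishing_of_stubs`, `exchange_of_stubs`; the derived set contains
`P (f i₀) = P {n ≤ x < 2n} = det X` (`target_of_stubs`), and `Derivable` is monotone in the target. [folklore] -/
theorem CondensationSound_of : CondensationSound := by
  intro n m' h l f hvalid htgt
  classical
  let P : Finset (Fin (n + m')) → FractionRing (MvPolynomial (Fin n × Fin m') ℂ) := fun J =>
    if hJ : J.card = n then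
      algebraMap (MvPolynomial (Fin n × Fin m') ℂ) (FractionRing (MvPolynomial (Fin n × Fin m') ℂ))
        (((Matrix.fromCols (1 : Matrix (Fin n) (Fin n) (MvPolynomial (Fin n × Fin m') ℂ))
          (Matrix.of fun i j => MvPolynomial.X (i, j))).submatrix id ⇑finSumFinEquiv.symm).submatrix
            id ⇑(J.orderEmbOfFin hJ)).det
    else 0
  have hP : ∀ (J : Finset (Fin (n + m'))) (hJ : J.card = n), P J =
      algebraMap (MvPolynomial (Fin n × Fin m') ℂ) (FractionRing (MvPolynomial (Fin n × Fin m') ℂ))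
        (((Matrix.fromCols (1 : Matrix (Fin n) (Fin n) (MvPolynomial (Fin n × Fin m') ℂ))
          (Matrix.of fun i j => MvPolynomial.X (i, j))).submatrix id ⇑finSumFinEquiv.symm).submatrix
            id ⇑(J.orderEmbOfFin hJ)).det := fun J hJ => dif_pos hJ
  have hD := stub_simulation (FractionRing (MvPolynomial (Fin n × Fin m') ℂ)) _ n m' P
    (ball_of_stubs n m' P hP) (nonvanishing_of_stubs n m' P hP) (exchange_of_stubs n m' P hP) l f hvalid
  obtain ⟨i₀, hi₀⟩ := htgt
  refine hD.mono le_rfl subset_rfl ?_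
  intro x hx
  rw [Set.mem_singleton_iff] at hx
  subst hx
  refine ⟨i₀, ?_⟩
  show P (f i₀) = _
  rw [hi₀]
  exact target_of_stubs n m' P hP h

end Summit.MatrixMultiplication.MatrixMultiplication.Theorems.CondensationSound
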